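import Literature.Claims.NS.Lietz2026
import Literature.Analysis.FluidPDE.NSCoriolisTorus
import HarnessLib

/-!
# CLAIM C172 `Belanger2026` — «Unconditional Rigidity of Bounded Ancient Solutions of the Periodic
Navier–Stokes Equations / A Finite Backward Palinstrophy Budget on the Three-Torus» (J. O. Magee Bélanger,
preprint, Zenodo record 21046255 = version «2.1.2» of concept 20129089, created 2026-06-29, 60 pp.; text of
record = PDF «JVE-MB-NS-PROBLEM-B_T3_Rigidity_Journal_v2.1.2.pdf», sha16 4b403f1e2f5a943e, PDF page =
printed page; cell ns-claims, D-0090, RULINGS v1.47 (1))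

[claim: Belanger2026, status: disputed] — NOTHING in this file is asserted as a theorem of the tree except
the declarations explicitly marked PROVED (pure logic / tree facts). Every `def Step_… : Prop` is the
AUTHOR'S assertion, typed as printed, with its locator.

WHAT THIS IS NOT: not a claim about NS regularity or blow-up; not a claim about any author beyond the
typed locator.

## Claimed statement (Thm 1.1 p.7 l.3–7) — TWO SENTENCES, TWO FACES
«Let ν > 0. There exists no nontrivial bounded ancient suitable weak solution of the unforced
Navier–Stokes equations (1) on the fixed torus T³ × (−∞, 0]. Equivalently, every smooth, mean-zero,
divergence-free datum u0 launches a solution of (1) that remains smooth for all t > 0.»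
* sentence 1 = `ClaimedRigidity` (over the class `IsBoundedAncient` = Definition 3.1 p.13 l.54–72, clause
  by clause: divergence-free, ZERO SPATIAL MEAN, BOTH suprema (6) finite, solves (1));
* sentence 2 = `ClaimedTheorem` (= Clay (B) on mean-zero data; letter-identical to the existence half of
  C167 `Lietz2026.ClaimedExistence`, same data class `Lietz2026.IsDatum`; `claimedTheorem_iff_clayB` PROVED);
* the printed «Equivalently» = §4 «rescaling reduction», Props 4.1–4.3 pp. 15–19 (`Step_P41`, `Step_B1`,
  `Step_P42`, `Step_P42c`, `Step_P43`).

## Grain notes (not Clay deltas)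
* TORUS. The print's torus is `(ℝ/2πℤ)³`; the tree's is the unit torus `T3 = UnitAddTorus (Fin 3)`
  (period 1, volume 1, first Laplace eigenvalue `4π²`). The fixed NS rescaling `u ↦ 2π·u(2π·x, 4π²·t)` maps
  one to the other at the same `ν`; printed constants `|T³| = (2π)³` (Lemma 9.1) and `E ≤ ½Ω` (Lemma
  13.12 (20)) read `1` and `8π² E ≤ Ω` here.
* CLASS GRAIN. Def 3.1's last two clauses («solves (1) in the sense of distributions on T³ × (−∞, 0); and
  the local energy inequality of Caffarelli–Kohn–Nirenberg holds on every parabolic subcylinder») are typed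
  at the SMOOTH grain the print itself asserts for every member of its class and uses from §3 on (p.14
  l.2–5: «By interior parabolic regularity for (1), a bounded ancient suitable weak solution with bounded
  vorticity is smooth on T³ × (−∞, 0); all manipulations below are therefore licit»; Lemma 13.12 proof
  p.34 l.57 «for the smooth ancient solution»): `Torus.IsClassicalNSSolutionOn (Iio 0) ν 0 U P` on the
  OPEN half-line, exactly as printed «(−∞, 0)». The tree has no periodic suitable-weak predicate on
  `(−∞, 0)` (`Torus.IsWeakNSSolutionOn` is forward `(0, T)` and pressure-free).
  -- TODO(general form): distributional + CKN-LEI class on `𝕋³ × (−∞, 0)`.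
* `u ≢ 0` for an `L∞` field on `T³ × (−∞, 0]` is an a.e. statement; at the smooth grain it is typed
  `IsNontrivial U := ∃ t < 0, U t ≠ 0` (the slice `t = 0` is null and carries no equation).
* The sup-bounds (6) are typed verbatim as the EXISTENCE of the two finite suprema over `t ≤ 0`
  (`velBound`, `vortBound`, with `|ω|² = torusVorticitySqAt`).

## ORDERED STEP INDEX (dependency order of the printed Proof of Thm 1.1, p.35 l.41–53)
 1. `Step_P41`  — Prop 4.1 (Object A) p.15 l.74–92: blow-up ⇒ rescaled limit on ℝ³, ‖U∞‖ ≤ 1, |U∞(0,0)| = 1.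
                  TRUE-type (standard compactness); pointwise-limit grain.
 2. `Step_B1`   — proof of Prop 4.2, opening p.17 l.53–59 + Step B1 p.18 l.13–17 + Step B2 l.18–20: the
                  blowing-up `u` obeys ONE pair of bounds `‖u(t)‖_∞ ≤ M_u`, `‖ω(t)‖_∞ ≤ M` on `[0, T⋆)`
                  («hence uniform in k»). KERNEL: `step_B1_iff_claimedTheorem` (PROVED, BKM door) —
                  in-skeleton `Step_B1 ↔ ClaimedTheorem`.
    `Step_B1_lit` — the same sentence read per closed subinterval («on each closed subinterval of its
                  existence interval») — TRUE-type (continuity on compacts).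
 3. `Step_P42`  — Prop 4.2 (Object B) p.15 l.93 – p.16 l.10 AS PRINTED with `M_u`, `M` = the bounds of `u`
                  of its proof (Step B1/B2/B4): blow-up ⇒ ∃ nontrivial Def-3.1 object on the FIXED torus
                  bounded by the same `M_u`, `M` that bound `u` on `[0, T⋆)`. KERNEL:
                  `step_P42_iff_claimedTheorem` (PROVED) — in-skeleton `Step_P42 ↔ ClaimedTheorem`.
    `Step_P42c` — the REF's ONE charitable retype (RULINGS v1.47 (2)): bounds read as ∃ finite suprema of
                  the limit object only. KERNEL: `step_P42c_iff_claimedTheorem_of_rigidity` (PROVED):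
                  `ClaimedRigidity → (Step_P42c ↔ ClaimedTheorem)`.
 4. `Step_P43`  — Prop 4.3 p.19 l.2–70: a nontrivial member of the class has `ω ≢ 0`. TRUE-type.
 5. `Step_L91`  — Lemma 9.1 p.25 l.50–70 energy ceiling `E(t) ≤ ½ M_u² |T³|`. TRUE-type.
 6. `Step_L93`  — Lemma 9.3 p.26 l.25–42 finite backward enstrophy budget. TRUE-type.
 7. `Step_L35`  — Lemma 3.5 p.14 l.188 pointwise production bound `|P(t)| ≤ (M/√2) Ω(t)`. TRUE-type.
 8. `Step_L111` — Lemma 11.1 p.27 l.24–40 bridge `∫|P| ≤ (M/√2)∫Ω < ∞`. TRUE-type.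
 9. `Step_T121` — Thm 12.1 p.28 l.17–40 finite backward palinstrophy budget. TRUE-type at the smooth grain.
10. `Step_L132` — Lemmas 13.1/13.2 p.30: `Ω(−σ) → 0`. TRUE-type.
11. `Step_T1310` — Thm 13.10 p.33 l.44–54 as USED («Let u be a bounded ancient solution … for which the
                  budget chain of Theorem 12.1 holds … suppose … nontrivial» ⇒ contradiction). TRUE-type
                  (indeed the class alone is rigid: `ClaimedRigidity` is TRUE-type by energy decay, LOCATORS §3).
12. `rigidity_of_steps : Step_L91 → Step_L93 → Step_L35 → Step_L111 → Step_T121 → Step_L132 → Step_T1310 →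
     ClaimedRigidity` and `claim_of_steps : Step_P42c → (…rigidity chain…) → ClaimedTheorem` — PROVED.
13. Clay link PROVED: `claimedTheorem_iff_clayB : ClaimedTheorem ↔ ClayVariants.clayPeriodic.Regularity`;
    `claimedTheorem_iff_noBlowup` PROVED (tree maximal-solution door).
-/

open Set MeasureTheory Filter Topology

namespace Literature.Claims.NS.Belanger2026

open Literature.Analysis Literature.Analysis.FluidPDE Literature.Analysis.FunctionSpaces
  Literature.Claims.NS.ClayVariants
open Literature.Claims.NS.Higgins2026 (T3 E3)
open Literature.Claims.NS.Lietz2026 (IsDatum vort)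

noncomputable section

/-! ## §A Vocabulary: the functionals (4) p.7 l.52–72 and the class of Definition 3.1 -/

/-- Enstrophy `Ω = ∫_{T³} |ω|²` ((4) p.7; `|ω(x)|² = torusVorticitySqAt`). [cite: Belanger2026, (4) p.7 l.52–72] -/
def enstrophy (v : T3 → E3) : ℝ := ∫ x, torusVorticitySqAt v x

/-- Palinstrophy `G = ∫_{T³} |∇ω|² = ∫ ∑ₖ |∂ₖ ω|²` ((4) p.7; `∂ₖ` commutes with `curl`).
[cite: Belanger2026, (4) p.7 l.52–72] -/
def palinstrophy (v : T3 → E3) : ℝ := ∫ x, ∑ k, torusVorticitySqAt (Torus.partialDeriv k v) x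

/-- Vortex-stretching production `P = ∫_{T³} ω · Sω = ∫ ∑ᵢⱼ ωᵢ ωⱼ ∂ᵢvⱼ` ((4) p.7; the antisymmetric part of
`∇v` drops out of `ω·(∇v)ω`). [cite: Belanger2026, (4) p.7 l.52–72] -/
def production (v : T3 → E3) : ℝ :=
  ∫ x, ∑ i, ∑ j, (vort v x) i * (vort v x) j * (Torus.partialDeriv i v x) j

/-- **Definition 3.1 (Bounded ancient suitable weak solution) p.13 l.54–72**, clause by clause: «A field
u: T³ × (−∞, 0] → R³ is a bounded ancient suitable weak solution of (1) if: u is divergence-free and of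
zero spatial mean; the velocity and the vorticity are uniformly bounded in time, that is
M_u := sup_{t≤0} ‖u(·,t)‖_{L∞(T³)} < ∞, M := sup_{t≤0} ‖ω(·,t)‖_{L∞(T³)} < ∞ (6) … these two finite numbers
M_u and M are part of the definition of the class …; The field u together with an associated pressure p
solves (1) in the sense of distributions on T³ × (−∞, 0); and the local energy inequality of
Caffarelli–Kohn–Nirenberg holds on every parabolic subcylinder.» The last two clauses at the smooth grain
the print asserts for its class (p.14 l.2–5; module docstring «CLASS GRAIN»).
[claim: Belanger2026, status: disputed] [cite: Belanger2026, Def 3.1 p.13 l.54–72; p.14 l.2–5] -/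
structure IsBoundedAncient (ν : ℝ) (U : ℝ → T3 → E3) (P : ℝ → T3 → ℝ) : Prop where
  /-- «u is divergence-free» (every `t ≤ 0`). -/
  divFree : ∀ t : ℝ, t ≤ 0 → Torus.IsDivFree (U t)
  /-- «and of zero spatial mean» (every `t ≤ 0`). -/
  zeroMean : ∀ t : ℝ, t ≤ 0 → Torus.HasZeroMean (U t)
  /-- (6), first supremum: `M_u := sup_{t≤0} ‖u(·,t)‖_∞ < ∞`. -/
  velBound : ∃ Mu : ℝ, ∀ t : ℝ, t ≤ 0 → ∀ x, ‖U t x‖ ≤ Mu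
  /-- (6), second supremum: `M := sup_{t≤0} ‖ω(·,t)‖_∞ < ∞` (`|ω|² ≤ M²`). -/
  vortBound : ∃ M : ℝ, ∀ t : ℝ, t ≤ 0 → ∀ x, torusVorticitySqAt (U t) x ≤ M ^ 2
  /-- «solves (1) … on T³ × (−∞, 0)» with a pressure, unforced, viscosity `ν` (smooth grain, p.14 l.2–5). -/
  solves : Torus.IsClassicalNSSolutionOn (Iio 0) ν 0 U P

/-- «It is nontrivial if u ≢ 0» (p.13 l.72), at the smooth grain: some slice `t < 0` is nonzero.
[cite: Belanger2026, Def 3.1 p.13 l.72] -/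
def IsNontrivial (U : ℝ → T3 → E3) : Prop := ∃ t : ℝ, t < 0 ∧ U t ≠ 0

/-- Finite backward budget of a time functional `F` along `U`: `∫_{−∞}^{0} F(U(t)) dt < ∞`, typed on the open
half-line as a uniform bound of `∫_a^b F(U t) dt` over `a < b < 0` (Lemma 9.3 / Thm 12.1 shape).
[cite: Belanger2026, Lemma 9.3 p.26 l.25–42; Thm 12.1 p.28 l.17–40] -/
def HasFiniteBackwardBudget (F : (T3 → E3) → ℝ) (U : ℝ → T3 → E3) : Prop :=
  ∃ B : ℝ, ∀ a b : ℝ, a < b → b < 0 → ∫ t in a..b, F (U t) ≤ B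

/-! ## §B The claimed statement: two faces -/

/-- **Sentence 1 of Thm 1.1 p.7 l.3–5 (RIGIDITY face)**: «Let ν > 0. There exists no nontrivial bounded
ancient suitable weak solution of the unforced Navier–Stokes equations (1) on the fixed torus
T³ × (−∞, 0].» — over the class of Def 3.1 (`IsBoundedAncient`, zero mean and both suprema built in).
TRUE-type (energy identity + torus Poincaré on the mean-zero subspace + the `L∞` ceiling; LOCATORS §3).
[claim: Belanger2026, status: disputed] [cite: Belanger2026, Thm 1.1 p.7 l.3–5; Def 3.1 p.13 l.54–72] -/
def ClaimedRigidity : Prop :=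
  ∀ ν : ℝ, 0 < ν → ∀ (U : ℝ → T3 → E3) (P : ℝ → T3 → ℝ), IsBoundedAncient ν U P → ¬ IsNontrivial U

/-- **Sentence 2 of Thm 1.1 p.7 l.6–7 (REGULARITY face = the row's CLAIMED THEOREM)**: «Equivalently, every
smooth, mean-zero, divergence-free datum u0 launches a solution of (1) that remains smooth for all
t > 0.» (`ν > 0` arbitrary, unforced, `𝕋³`): for every `ν > 0` and every `u₀` with `Lietz2026.IsDatum u₀`
(smooth ∧ divergence-free ∧ zero-mean) a classical solution `(u, p)` on `[0, ∞) × 𝕋³` with `u(0) = u₀` —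
letter-identical to C167's existence half `Lietz2026.ClaimedExistence` (cited, not restated).
[claim: Belanger2026, status: disputed] [cite: Belanger2026, Thm 1.1 p.7 l.6–7] -/
def ClaimedTheorem : Prop := Lietz2026.ClaimedExistence

/-- `ClaimedTheorem` unfolds to C167's existence half. [cite: Belanger2026, Thm 1.1 p.7 l.6–7] -/
theorem claimedTheorem_iff_lietzExistence : ClaimedTheorem ↔ Lietz2026.ClaimedExistence := Iff.rfl

/-- **The blow-up hypothesis of §4** (Props 4.1/4.2 «Suppose a smooth solution u of (1) first loses
regularity at a finite time T⋆ < ∞», p.15 l.75–76; proof of Prop 4.2 p.17 l.53–55 «a smooth solution u on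
T³ × [0, T⋆) losing regularity at T⋆ < ∞»), in the tree's maximal-solution vocabulary: a classical solution
on `[0, T⋆)` from a datum of the class, through whose datum NO classical solution lives on a closed window
`[0, b]` with `b ≥ T⋆`. [cite: Belanger2026, Prop 4.1 p.15 l.74–76; proof of Prop 4.2 p.17 l.53–55] -/
def IsBlowup (ν : ℝ) (u : ℝ → T3 → E3) (p : ℝ → T3 → ℝ) (T : ℝ) : Prop :=
  0 < T ∧ IsDatum (u 0) ∧ Torus.IsClassicalNSSolutionOn (Ico 0 T) ν 0 u p ∧
    ∀ (b : ℝ) (v : ℝ → T3 → E3) (q : ℝ → T3 → ℝ),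
      Torus.IsClassicalNSSolutionOn (Icc 0 b) ν 0 v q → v 0 = u 0 → b < T

/-! ## §C The Steps of the printed argument -/

/-- **Step 1 — Proposition 4.1 (Object A: local bounded ancient limit, certifying nontriviality) p.15
l.74–92**: «Suppose a smooth solution u of (1) first loses regularity at a finite time T⋆ < ∞. Then there
exist scales λk → 0, points xk ∈ T³, times tk ↑ T⋆, and a limit field U∞, defined on each fixed compact
subset of R³ × (−∞, 0], such that the parabolic rescalings Uk(y, s) = λk u(xk + λk y, tk + λk² s) converge to
U∞ in C¹_loc, with ‖U∞‖_{L∞} ≤ 1 and |U∞(0, 0)| = 1. No periodicity of U∞ is claimed or used.» Typed with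
POINTWISE convergence on `ℝ³ × (−∞, 0]` (weaker than the printed `C¹_loc`; grain). TRUE-type (standard).
[claim: Belanger2026, status: disputed] [cite: Belanger2026, Prop 4.1 p.15 l.74–92; Step A1 p.16 l.46–62] -/
def Step_P41 : Prop :=
  ∀ ν : ℝ, 0 < ν → ∀ (u : ℝ → T3 → E3) (p : ℝ → T3 → ℝ) (T : ℝ), IsBlowup ν u p T →
    ∃ (lam : ℕ → ℝ) (xk : ℕ → T3) (tk : ℕ → ℝ) (Uinf : ℝ → E3 → E3),
      (∀ k, 0 < lam k) ∧ Tendsto lam atTop (𝓝 0) ∧ (∀ k, 0 ≤ tk k ∧ tk k < T) ∧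
      Tendsto tk atTop (𝓝 T) ∧ (∀ s : ℝ, s ≤ 0 → ∀ y, ‖Uinf s y‖ ≤ 1) ∧ ‖Uinf 0 0‖ = 1 ∧
      ∀ s : ℝ, s ≤ 0 → ∀ y : E3,
        Tendsto (fun k => lam k • u (tk k + lam k ^ 2 * s) (xk k + Torus.proj (lam k • y))) atTop
          (𝓝 (Uinf s y))

/-- **Step 2 — the bounds sentence of the proof of Prop 4.2** (opening p.17 l.53–59: «The blow-up hypothesis
furnishes a smooth solution u on T³ × [0, T⋆) losing regularity at T⋆ < ∞; on each closed subinterval of its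
existence interval it satisfies the a priori bounds ‖u(·, t)‖_{L∞} ≤ M_u and ‖ω(·, t)‖_{L∞} ≤ M, the two finite
suprema that the definition Definition 3.1 of an ancient solution requires»; Step B1 p.18 l.13–17: «V_k
carries, by definition of its ancient class, the a priori bounds ‖V_k(·, s)‖_{L∞} ≤ M_u and ‖curl V_k(·, s)‖_{L∞}
≤ M directly»; Step B2 p.18 l.18–20: «bounded there by M_u, with ‖curl V_k‖_{L∞} ≤ M … hence uniform in k»),
typed as USED: ONE pair `(M_u, M)` bounding the blowing-up `u` on all of `[0, T⋆)`. The print fixes no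
display for these numbers (LOCATORS v2 §1b); its Step A1 p.16 l.48–50 has `‖u(·,t_k)‖_∞ → ∞`. KERNEL:
`step_B1_iff_claimedTheorem`. [claim: Belanger2026, status: disputed]
[cite: Belanger2026, proof of Prop 4.2 p.17 l.53–59; Step B1 p.18 l.13–17; Step B2 p.18 l.18–20] -/
def Step_B1 : Prop :=
  ∀ ν : ℝ, 0 < ν → ∀ (u : ℝ → T3 → E3) (p : ℝ → T3 → ℝ) (T : ℝ), IsBlowup ν u p T →
    ∃ Mu M : ℝ, ∀ t ∈ Ico 0 T, ∀ x, ‖u t x‖ ≤ Mu ∧ torusVorticitySqAt (u t) x ≤ M ^ 2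

/-- **Step 2, literal per-subinterval reading** of p.17 l.55–56 («on each closed subinterval of its
existence interval it satisfies the a priori bounds …»): on every `[0, b]`, `b < T⋆`, SOME finite bounds
(depending on `b`). TRUE-type (smooth on a compact set). [claim: Belanger2026, status: disputed]
[cite: Belanger2026, proof of Prop 4.2 p.17 l.55–56] -/
def Step_B1_lit : Prop :=
  ∀ ν : ℝ, 0 < ν → ∀ (u : ℝ → T3 → E3) (p : ℝ → T3 → ℝ) (T : ℝ), IsBlowup ν u p T →
    ∀ b : ℝ, 0 ≤ b → b < T →
      ∃ Mu M : ℝ, ∀ t ∈ Icc 0 b, ∀ x, ‖u t x‖ ≤ Mu ∧ torusVorticitySqAt (u t) x ≤ M ^ 2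

/-- **Step 3 — Proposition 4.2 (Object B: a nontrivial bounded ancient solution on the fixed torus) p.15
l.93 – p.16 l.10, AS PRINTED**: «Under the same hypothesis there exists a nontrivial bounded ancient
suitable weak solution U^T_∞ on the fixed torus T³ × (−∞, 0], in the sense of Definition 3.1, with
sup_{s≤0} ‖U^T_∞(·,s)‖_{L∞(T³)} ≤ M_u, sup_{s≤0} ‖ω^T_∞(·,s)‖_{L∞(T³)} =: M < ∞», with `M_u`, `M` the numbers
of its proof (Step 2: the bounds of the blowing-up `u` on `[0, T⋆)`, inherited by the limit in Step B4
p.18 l.49–93). KERNEL: `step_P42_iff_claimedTheorem`. [claim: Belanger2026, status: disputed]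
[cite: Belanger2026, Prop 4.2 p.15 l.93 – p.16 l.10; proof p.17 l.52 – p.18 l.112] -/
def Step_P42 : Prop :=
  ∀ ν : ℝ, 0 < ν → ∀ (u : ℝ → T3 → E3) (p : ℝ → T3 → ℝ) (T : ℝ), IsBlowup ν u p T →
    ∃ Mu M : ℝ, (∀ t ∈ Ico 0 T, ∀ x, ‖u t x‖ ≤ Mu ∧ torusVorticitySqAt (u t) x ≤ M ^ 2) ∧
      ∃ (U : ℝ → T3 → E3) (P : ℝ → T3 → ℝ), IsBoundedAncient ν U P ∧ IsNontrivial U ∧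
        ∀ s : ℝ, s ≤ 0 → ∀ x, ‖U s x‖ ≤ Mu ∧ torusVorticitySqAt (U s) x ≤ M ^ 2

/-- **Step 3′ — Prop 4.2 under the REF's ONE charitable retype** (RULINGS v1.47 (2): «Object B's bounds read
as ∃ finite suprema of the TRANSLATES on (−∞, 0] ∩ domain», i.e. just membership in Def 3.1): blow-up ⇒
some nontrivial member of the class. KERNEL: `step_P42c_iff_claimedTheorem_of_rigidity`.
[claim: Belanger2026, status: disputed] [cite: Belanger2026, Prop 4.2 p.15 l.93 – p.16 l.10] -/
def Step_P42c : Prop :=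
  ∀ ν : ℝ, 0 < ν → ∀ (u : ℝ → T3 → E3) (p : ℝ → T3 → ℝ) (T : ℝ), IsBlowup ν u p T →
    ∃ (U : ℝ → T3 → E3) (P : ℝ → T3 → ℝ), IsBoundedAncient ν U P ∧ IsNontrivial U

/-- **Step 4 — Proposition 4.3 p.19 l.2–70** («U^T_∞ is non-constant in space; consequently ω^T_∞ ≢ 0»),
typed as the class property it rests on: a nontrivial member of Def 3.1 (mean zero, divergence-free) has
non-vanishing vorticity at some time. TRUE-type (curl-free + div-free + mean-zero on 𝕋³ ⇒ 0).
[claim: Belanger2026, status: disputed] [cite: Belanger2026, Prop 4.3 p.19 l.2–70; Step B5 p.18 l.94–112] -/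
def Step_P43 : Prop :=
  ∀ ν : ℝ, 0 < ν → ∀ (U : ℝ → T3 → E3) (P : ℝ → T3 → ℝ), IsBoundedAncient ν U P → IsNontrivial U →
    ∃ t : ℝ, t < 0 ∧ ∃ x, torusVorticitySqAt (U t) x ≠ 0

/-- **Step 5 — Lemma 9.1 (Energy ceiling) p.25 l.50–70**: «E(t) ≤ ½ M_u² |T³|» for every `t ≤ 0` (unit
torus: `|T³| = 1`). TRUE-type. [claim: Belanger2026, status: disputed] [cite: Belanger2026, Lemma 9.1 p.25 l.50–70] -/
def Step_L91 : Prop :=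
  ∀ ν : ℝ, 0 < ν → ∀ (U : ℝ → T3 → E3) (P : ℝ → T3 → ℝ), IsBoundedAncient ν U P →
    ∀ Mu : ℝ, (∀ t : ℝ, t ≤ 0 → ∀ x, ‖U t x‖ ≤ Mu) →
      ∀ t : ℝ, t < 0 → Torus.kineticEnergy (U t) ≤ 2⁻¹ * Mu ^ 2

/-- **Step 6 — Lemma 9.3 (Backward enstrophy budget) p.26 l.25–42**: «E∞ := lim_{σ→∞} E(−σ) exists, is
finite, and ν∫_{−∞}^0 Ω(t) dt = E∞ − E(0) < ∞» (from Ė = −νΩ ≤ 0, Lemma 3.2 p.14, and the ceiling), typed as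
the finite backward budget of `Ω = ∫|ω|²`. TRUE-type. [claim: Belanger2026, status: disputed]
[cite: Belanger2026, Lemma 9.3 p.26 l.25–42; Lemma 3.2 p.14 l.15–40] -/
def Step_L93 : Prop :=
  ∀ ν : ℝ, 0 < ν → ∀ (U : ℝ → T3 → E3) (P : ℝ → T3 → ℝ), IsBoundedAncient ν U P →
    HasFiniteBackwardBudget enstrophy U

/-- **Step 7 — Lemma 3.5 (Production bound, pointwise) p.14 l.188**: «|P(t)| ≤ (M/√2) Ω(t)» with
`M = ‖ω‖_{L∞}` (the abstract p.1 prints `M/2`; records). TRUE-type.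
[claim: Belanger2026, status: disputed] [cite: Belanger2026, Lemma 3.5 p.14 l.188] -/
def Step_L35 : Prop :=
  ∀ ν : ℝ, 0 < ν → ∀ (U : ℝ → T3 → E3) (P : ℝ → T3 → ℝ), IsBoundedAncient ν U P →
    ∀ M : ℝ, 0 ≤ M → (∀ t : ℝ, t ≤ 0 → ∀ x, torusVorticitySqAt (U t) x ≤ M ^ 2) →
      ∀ t : ℝ, t < 0 → |production (U t)| ≤ M / Real.sqrt 2 * enstrophy (U t)

/-- **Step 8 — Lemma 11.1 (bridge) p.27 l.24–40**: «∫_{−∞}^0 |P(t)| dt ≤ (M/√2) ∫_{−∞}^0 Ω(t) dt < ∞»: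
finite backward budget of `|P|` from that of `Ω`. TRUE-type.
[claim: Belanger2026, status: disputed] [cite: Belanger2026, Lemma 11.1 p.27 l.24–40] -/
def Step_L111 : Prop :=
  ∀ ν : ℝ, 0 < ν → ∀ (U : ℝ → T3 → E3) (P : ℝ → T3 → ℝ), IsBoundedAncient ν U P →
    HasFiniteBackwardBudget enstrophy U → HasFiniteBackwardBudget (fun v => |production v|) U

/-- **Step 9 — Theorem 12.1 (Finite backward palinstrophy budget) p.28 l.17–40**: «∫_{−∞}^0 G(t) dt =
∫_{−∞}^0 ∫_{T³} |∇ω|² dx dt < ∞, with the explicit bound ν∫G ≤ ∫|P| + ½Ω(0)» (enstrophy balance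
Ω̇ = P − νG, Lemma 3.4). TRUE-type at the smooth grain.
[claim: Belanger2026, status: disputed] [cite: Belanger2026, Thm 12.1 p.28 l.17–40; Lemma 3.4 p.14] -/
def Step_T121 : Prop :=
  ∀ ν : ℝ, 0 < ν → ∀ (U : ℝ → T3 → E3) (P : ℝ → T3 → ℝ), IsBoundedAncient ν U P →
    HasFiniteBackwardBudget (fun v => |production v|) U → HasFiniteBackwardBudget palinstrophy U

/-- **Step 10 — Lemmas 13.1/13.2 p.30 l.26, l.59** («the full backward enstrophy limit exists», «Ω∞ = 0»):
a finite backward enstrophy budget forces `Ω(−σ) → 0` as `σ → ∞` (with the Lipschitz-in-time control of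
Lemma 5.1 p.19). TRUE-type. [claim: Belanger2026, status: disputed]
[cite: Belanger2026, Lemma 13.1 p.30 l.26; Lemma 13.2 p.30 l.59; Lemma 5.1 p.19] -/
def Step_L132 : Prop :=
  ∀ ν : ℝ, 0 < ν → ∀ (U : ℝ → T3 → E3) (P : ℝ → T3 → ℝ), IsBoundedAncient ν U P →
    HasFiniteBackwardBudget enstrophy U → Tendsto (fun t => enstrophy (U t)) atBot (𝓝 0)

/-- **Step 11 — Theorem 13.10 (No nontrivial bounded ancient solution) p.33 l.44–54, as USED**: «There is no
nontrivial bounded ancient solution of (1) on T³ × (−∞, 0]»; proof opening l.47–48 «Let u be a bounded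
ancient solution on T³ × (−∞, 0] for which the budget chain of Theorem 12.1 holds, and suppose for
contradiction that u is nontrivial» (Step 1 l.49–54 invokes «the nontrivial terminal trace |U(0, 0)| = 1 of
Proposition 4.2» — printed only for Object A, Prop 4.1; Lemma 13.7 p.32 ESŠ-type backward uniqueness;
Lemma 13.12 p.34 torus Poincaré (20)–(21)). Typed: class ∧ finite palinstrophy budget ∧ `Ω(−σ) → 0` ⇒
trivial. TRUE-type (the class alone is rigid). [claim: Belanger2026, status: disputed]
[cite: Belanger2026, Thm 13.10 p.33 l.44–54; Lemma 13.7 p.32 l.38–65; Lemma 13.12 p.34 l.46–58] -/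
def Step_T1310 : Prop :=
  ∀ ν : ℝ, 0 < ν → ∀ (U : ℝ → T3 → E3) (P : ℝ → T3 → ℝ), IsBoundedAncient ν U P →
    HasFiniteBackwardBudget palinstrophy U → Tendsto (fun t => enstrophy (U t)) atBot (𝓝 0) →
      ¬ IsNontrivial U

/-! ## §D Compositions (PROVED, pure logic + tree facts) -/

/-- **RIGIDITY CHAIN (PROVED composition)** — Proof of Thm 1.1 p.35 l.44–50 restricted to sentence 1: on a
member of Def 3.1, Lemma 9.3 ⇒ Lemma 11.1 ⇒ Thm 12.1 (budget) and Lemmas 13.1/13.2 (`Ω(−σ) → 0`) ⇒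
Thm 13.10. (Lemma 9.1 and Lemma 3.5 are consumed inside Lemma 9.3 / Lemma 11.1 in print; listed for the
ordered index.) [cite: Belanger2026, Proof of Thm 1.1 p.35 l.41–53] -/
theorem rigidity_of_steps (_h91 : Step_L91) (h93 : Step_L93) (_h35 : Step_L35) (h111 : Step_L111)
    (h121 : Step_T121) (h132 : Step_L132) (h1310 : Step_T1310) : ClaimedRigidity := by
  intro ν hν U P hU
  have hΩ := h93 ν hν U P hU
  exact h1310 ν hν U P hU (h121 ν hν U P hU (h111 ν hν U P hU hΩ)) (h132 ν hν U P hU hΩ)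

/-- **`ClaimedTheorem` ⇔ «no smooth mean-zero datum blows up»** (PROVED; the tree's maximal classical
solution `Torus.exists_maximal_classicalNS_anyMean`, RRS 2016 §6.3/§8.1): the content of the word
«Equivalently» on the REGULARITY side. [cite: RobinsonRodrigoSadowskiCUP2016, §6.3 p. 108 and §8.1 p. 122]
[cite: Belanger2026, Thm 1.1 p.7 l.6–7; Proof of Thm 1.1 p.35 l.50–53] -/
theorem claimedTheorem_iff_noBlowup :
    ClaimedTheorem ↔ ∀ ν : ℝ, 0 < ν → ∀ (u : ℝ → T3 → E3) (p : ℝ → T3 → ℝ) (T : ℝ), ¬ IsBlowup ν u p T := by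
  constructor
  · rintro h ν hν u p T ⟨hT, hdat, -, hmax⟩
    obtain ⟨U, P, hU, hU0⟩ := h ν hν (u 0) hdat
    exact lt_irrefl T (hmax T U P (hU.mono Icc_subset_Ici_self (uniqueDiffOn_Icc hT)) hU0)
  · intro h ν hν u₀ hu₀
    obtain ⟨u, p, hu0, hcases⟩ :=
      Torus.exists_maximal_classicalNS_anyMean (d := Fin 3) (by simp) hν hu₀.1 hu₀.2.1
    rcases hcases with ⟨hglob, -⟩ | ⟨T, hT, hcl, -, hmax⟩
    · exact ⟨u, p, hglob, hu0⟩
    · exfalso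
      refine h ν hν u p T ⟨hT, ?_, hcl, fun b v q hv hv0 => (hmax b v q hv (hv0.trans hu0)).1⟩
      rw [hu0]; exact hu₀

/-- Under the blow-up hypothesis a UNIFORM vorticity bound on `[0, T⋆)` is impossible (PROVED; the tree's
BKM continuation on `𝕋³`, `Torus.classicalNS_bkm_continuation_anyMean`, RRS 2016 Thm 12.3, against the
maximality clause of `IsBlowup`). [cite: RobinsonRodrigoSadowskiCUP2016, Thm 12.3]
[cite: Belanger2026, Step A1 p.16 l.46–62] -/
theorem not_uniform_vortBound_of_isBlowup {ν : ℝ} (hν : 0 < ν) {u : ℝ → T3 → E3} {p : ℝ → T3 → ℝ}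
    {T : ℝ} (h : IsBlowup ν u p T) {M : ℝ} (hM : ∀ t ∈ Ico 0 T, ∀ x, torusVorticitySqAt (u t) x ≤ M ^ 2) :
    False := by
  obtain ⟨hT, -, hcl, hmax⟩ := h
  obtain ⟨T', hTT', u', p', hcl', hagree⟩ :=
    Torus.classicalNS_bkm_continuation_anyMean (d := Fin 3) (by simp) hν hT hcl
      (M := fun _ => |M|) continuousOn_const (fun _ _ => abs_nonneg M)
      (fun t ht x => by rw [sq_abs]; exact hM t ht x) (I := T * |M|)
      (fun t ht => by
        rw [intervalIntegral.integral_const, smul_eq_mul, sub_zero]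
        exact mul_le_mul_of_nonneg_right ht.2.le (abs_nonneg M))
  exact absurd hTT' (not_lt.2 (hmax T' u' p' hcl' (hagree 0 ⟨le_rfl, hT⟩)).le)

/-- **KERNEL FACT at Step 2 (PROVED): `Step_B1 ↔ ClaimedTheorem`.** The bounds sentence of Prop 4.2's proof
— one pair `(M_u, M)` for the blowing-up `u` on `[0, T⋆)` — is, inside this skeleton, EQUIVALENT to the
regularity face it is meant to support: (→) a uniform `‖ω‖_∞` bound continues `u` past `T⋆` (BKM), so no
datum blows up; (←) with no blow-up the sentence has no instance. ROUTE-5b circular shape (precedent #151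
`Cox2025.step_setup_iff_claimedTheorem`). [cite: Belanger2026, proof of Prop 4.2 p.17 l.53–59; Step B1 p.18 l.13–17]
[cite: RobinsonRodrigoSadowskiCUP2016, Thm 12.3] -/
theorem step_B1_iff_claimedTheorem : Step_B1 ↔ ClaimedTheorem := by
  rw [claimedTheorem_iff_noBlowup]
  constructor
  · intro h ν hν u p T hbu
    obtain ⟨Mu, M, hB⟩ := h ν hν u p T hbu
    exact not_uniform_vortBound_of_isBlowup hν hbu (M := M) fun t ht x => (hB t ht x).2
  · intro h ν hν u p T hbu
    exact absurd hbu (h ν hν u p T)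

/-- **KERNEL FACT at Step 3 (PROVED): `Step_P42 ↔ ClaimedTheorem`** (Prop 4.2 as printed, with `M_u`, `M`
the bounds of the blowing-up `u`): same mechanism as `step_B1_iff_claimedTheorem`.
[cite: Belanger2026, Prop 4.2 p.15 l.93 – p.16 l.10] [cite: RobinsonRodrigoSadowskiCUP2016, Thm 12.3] -/
theorem step_P42_iff_claimedTheorem : Step_P42 ↔ ClaimedTheorem := by
  rw [claimedTheorem_iff_noBlowup]
  constructor
  · intro h ν hν u p T hbu
    obtain ⟨Mu, M, hB, -⟩ := h ν hν u p T hbu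
    exact not_uniform_vortBound_of_isBlowup hν hbu (M := M) fun t ht x => (hB t ht x).2
  · intro h ν hν u p T hbu
    exact absurd hbu (h ν hν u p T)

/-- `Step_P42` (as printed) implies the charitable retype `Step_P42c`. [cite: Belanger2026, Prop 4.2 p.15 l.93 – p.16 l.10] -/
theorem step_P42c_of_step_P42 (h : Step_P42) : Step_P42c := by
  intro ν hν u p T hbu
  obtain ⟨-, -, -, U, P, hU, hnt, -⟩ := h ν hν u p T hbu
  exact ⟨U, P, hU, hnt⟩

/-- **KERNEL FACT at Step 3′ (PROVED): given the rigidity face, `Step_P42c ↔ ClaimedTheorem`** — modus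
tollens: «blow-up ⇒ ∃ nontrivial member» ∧ «no nontrivial member» is «no blow-up» = sentence 2, and
conversely sentence 2 empties the premise. [cite: Belanger2026, Proof of Thm 1.1 p.35 l.41–53] -/
theorem step_P42c_iff_claimedTheorem_of_rigidity (hR : ClaimedRigidity) : Step_P42c ↔ ClaimedTheorem := by
  rw [claimedTheorem_iff_noBlowup]
  constructor
  · intro h ν hν u p T hbu
    obtain ⟨U, P, hU, hnt⟩ := h ν hν u p T hbu
    exact hR ν hν U P hU hnt
  · intro h ν hν u p T hbu
    exact absurd hbu (h ν hν u p T)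

/-- **COMPOSITION OF THE PRINTED CHAIN (PROVED)** — Proof of Thm 1.1 p.35 l.41–53: Prop 4.2 (charitable
retype; the literal `Step_P42` implies it, `step_P42c_of_step_P42`) produces from a blow-up a nontrivial
member of Def 3.1; the rigidity chain (Lemma 9.1 … Thm 13.10) excludes it; hence no blow-up, i.e.
sentence 2 (`claimedTheorem_iff_noBlowup`). Prop 4.1 (Object A) and Prop 4.3 are not consumed by the
kernel composition (their printed role — the trace |U∞(0,0)| = 1 and ω ≢ 0 — enters Thm 13.10's proof
Step 1 only). [cite: Belanger2026, Proof of Thm 1.1 p.35 l.41–53] -/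
theorem claim_of_steps (h42 : Step_P42c) (h91 : Step_L91) (h93 : Step_L93) (h35 : Step_L35)
    (h111 : Step_L111) (h121 : Step_T121) (h132 : Step_L132) (h1310 : Step_T1310) : ClaimedTheorem :=
  (step_P42c_iff_claimedTheorem_of_rigidity (rigidity_of_steps h91 h93 h35 h111 h121 h132 h1310)).1 h42

/-- The literal chain: `Step_P42` alone already yields `ClaimedTheorem` (kernel iff). [cite: Belanger2026, Prop 4.2 p.15 l.93 – p.16 l.10] -/
theorem claim_of_step_P42 (h42 : Step_P42) : ClaimedTheorem := step_P42_iff_claimedTheorem.1 h42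

/-! ## §E Clay link (PROVED): sentence 2 is EXACTLY Clay (B) -/

/-- **`ClaimedTheorem ↔ ClayVariants.clayPeriodic.Regularity`** (Clay (B), Fefferman (8)/(10)/(11); the
mean-zero clause is a WLOG normalisation by the tree's Galilean boost, and uniqueness is a tree fact —
both through C167's `Lietz2026.claimedTheorem_iff_clayB` / `claimedUniqueness_holds`).
[cite: FeffermanClay2006, (B) p. 2] [cite: Belanger2026, Thm 1.1 p.7 l.6–7] -/
theorem claimedTheorem_iff_clayB : ClaimedTheorem ↔ clayPeriodic.Regularity :=
  ⟨fun h => Lietz2026.clayB_of_claimed ⟨h, Lietz2026.claimedUniqueness_holds⟩,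
    fun h => (Lietz2026.claimed_of_clayB h).1⟩

/-- Clay (B) from the claimed theorem. [cite: FeffermanClay2006, (B) p. 2] [cite: Belanger2026, Thm 1.1 p.7 l.6–7] -/
theorem clayB_of_claimed (h : ClaimedTheorem) : clayPeriodic.Regularity := claimedTheorem_iff_clayB.1 h

/-! ## §F TRUE column (PROVED): the rigidity face of Thm 1.1 HOLDS in the kernel

Sentence 1 over the class of Definition 3.1 is a theorem of the tree by the elementary energy argument the
print itself records (Lemma 3.2 `Ė = −νΩ` p.14, Lemma 13.12 (20) torus Poincaré on the mean-zero subspace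
p.34, Lemma 9.1 ceiling p.25): along a member `U`, `t ↦ e^{8π²νt} E(U(t))` is non-increasing on `(−∞, 0)`,
while `E ≤ ½ M_u²`; letting `s → −∞` in `E(t) ≤ e^{−8π²ν(t−s)} · ½M_u²` gives `E(t) = 0`, hence `U(t) = 0`.
Consequently the charitable face closes unconditionally: `Step_P42c ↔ ClaimedTheorem`. -/

/-- **Lemma 9.1 at the smooth grain (PROVED)**: a smooth field with `‖v‖ ≤ M_u` pointwise has
`E(v) = ½∫‖v‖² ≤ ½ M_u²` on the unit torus (`|𝕋³| = 1`). [cite: Belanger2026, Lemma 9.1 p.25 l.50–70] -/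
theorem kineticEnergy_le_of_norm_le {v : T3 → E3} (hv : Torus.IsSmooth v) {Mu : ℝ}
    (hMu : ∀ x, ‖v x‖ ≤ Mu) : Torus.kineticEnergy v ≤ 2⁻¹ * Mu ^ 2 := by
  have h1 : ∫ x, ‖v x‖ ^ 2 ≤ ∫ _x : T3, Mu ^ 2 :=
    integral_mono hv.norm_sq.integrable (integrable_const _) fun x =>
      pow_le_pow_left₀ (norm_nonneg _) (hMu x) 2
  have h2 : ∫ _x : T3, Mu ^ 2 = Mu ^ 2 := by simp
  unfold Torus.kineticEnergy
  rw [h2] at h1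
  linarith

/-- **`Step_L91` HOLDS (PROVED)** (Lemma 9.1 energy ceiling). [cite: Belanger2026, Lemma 9.1 p.25 l.50–70] -/
theorem step_L91_holds : Step_L91 := by
  intro ν _hν U P hU Mu hMu t ht
  exact kineticEnergy_le_of_norm_le (hU.solves.smooth_velocity.isSmooth_slice ht) fun x => hMu t ht.le x

/-- **THE RIGIDITY FACE HOLDS (PROVED): `ClaimedRigidity`** — no nontrivial member of Definition 3.1 exists,
for every `ν > 0` (energy balance `Torus.IsClassicalNSSolutionOn.energy_balance_holds` on the convex
`(−∞, 0)`, Poincaré `Torus.integral_norm_sq_le_gradNormSq_of_hasZeroMean` on the mean-zero subspace, the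
ceiling `kineticEnergy_le_of_norm_le`, and backward exponential growth). [cite: Belanger2026, Thm 1.1 p.7 l.3–5; Lemma 3.2 p.14 l.15–40; Lemma 9.1 p.25 l.50–70; Lemma 13.12 (20) p.34 l.46–58]
[cite: BabinMahalovNicolaenko1999, Remark 5.2, (5.43)–(5.44) with F = 0] -/
theorem claimedRigidity_holds : ClaimedRigidity := by
  intro ν hν U P hU hnt
  obtain ⟨t, ht, hUt⟩ := hnt
  obtain ⟨Mu, hMu⟩ := hU.velBound
  set S : Set ℝ := Iio 0 with hSdef
  have hS : Convex ℝ S := convex_Iio 0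
  have htS : t ∈ S := ht
  set c : ℝ := 8 * Real.pi ^ 2 * ν with hc
  have hc0 : 0 < c := by rw [hc]; exact mul_pos (by positivity) hν
  set E : ℝ → ℝ := fun τ => Torus.kineticEnergy (U τ) with hE
  have hsm : ∀ τ ∈ S, Torus.IsSmooth (U τ) := fun τ hτ =>
    hU.solves.smooth_velocity.isSmooth_slice hτ
  -- Lemma 3.2: the energy balance of the unforced classical solution on `(−∞, 0)`
  have hdE : ∀ τ ∈ S, HasDerivWithinAt E (-ν * Torus.gradNormSq (U τ)) S τ := by
    intro τ hτ
    have h1 := Torus.IsClassicalNSSolutionOn.energy_balance_holds hU.solves hS hτ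
    simpa only [Pi.zero_apply, inner_zero_left, integral_zero, add_zero] using h1
  -- Lemma 13.12 (20): Poincaré on the mean-zero subspace, `8π² E ≤ ‖∇U‖²`
  have hP : ∀ τ ∈ S, 8 * Real.pi ^ 2 * E τ ≤ Torus.gradNormSq (U τ) := by
    intro τ hτ
    have hP' := Torus.integral_norm_sq_le_gradNormSq_of_hasZeroMean (hsm τ hτ)
      (hU.zeroMean τ (le_of_lt hτ))
    calc 8 * Real.pi ^ 2 * E τ = 4 * Real.pi ^ 2 * ∫ x, ‖U τ x‖ ^ 2 := by
          simp only [hE, Torus.kineticEnergy]; ring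
      _ ≤ _ := hP'
  -- `σ ↦ e^{cσ} E(σ)` is non-increasing on `S`
  have hdg : ∀ τ ∈ S, HasDerivWithinAt (fun σ => Real.exp (c * σ) * E σ)
      (Real.exp (c * τ) * (c * E τ - ν * Torus.gradNormSq (U τ))) S τ := by
    intro τ hτ
    have h1 : HasDerivAt (fun σ => Real.exp (c * σ)) (Real.exp (c * τ) * c) τ := by
      simpa using ((hasDerivAt_id τ).const_mul c).exp
    refine ((h1.hasDerivWithinAt (s := S)).mul (hdE τ hτ)).congr_deriv ?_
    ring
  have hg0 : ∀ τ ∈ S, Real.exp (c * τ) * (c * E τ - ν * Torus.gradNormSq (U τ)) ≤ 0 := by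
    intro τ hτ
    refine mul_nonpos_iff.2 (Or.inl ⟨Real.exp_nonneg _, ?_⟩)
    have e1 : c * E τ - ν * Torus.gradNormSq (U τ) =
        ν * (8 * Real.pi ^ 2 * E τ - Torus.gradNormSq (U τ)) := by
      rw [hc]; ring
    rw [e1]
    exact mul_nonpos_iff.2 (Or.inl ⟨hν.le, by linarith [hP τ hτ]⟩)
  have hanti : AntitoneOn (fun σ => Real.exp (c * σ) * E σ) S :=
    antitoneOn_of_hasDerivWithinAt_nonpos hS (fun τ hτ => (hdg τ hτ).continuousWithinAt)
      (fun τ hτ => (hdg τ (interior_subset hτ)).mono interior_subset)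
      (fun τ hτ => hg0 τ (interior_subset hτ))
  -- Lemma 9.1: the ceiling
  set C : ℝ := 2⁻¹ * Mu ^ 2 with hC
  have hceil : ∀ s ∈ S, E s ≤ C := fun s hs =>
    kineticEnergy_le_of_norm_le (hsm s hs) fun x => hMu s (le_of_lt hs) x
  -- backward comparison: `E(t) ≤ e^{−c(t−s)} · C` for every `s ≤ t`
  have hEt_le : ∀ s : ℝ, s ≤ t → E t ≤ Real.exp (-(c * (t - s))) * C := by
    intro s hst
    have hs : s ∈ S := lt_of_le_of_lt hst ht
    have h3 : Real.exp (c * t) * E t ≤ Real.exp (c * s) * E s := hanti hs htS hst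
    have h4 : E t ≤ Real.exp (c * s) * E s / Real.exp (c * t) :=
      (le_div_iff₀' (Real.exp_pos _)).2 h3
    have h5 : Real.exp (c * s) * E s / Real.exp (c * t) = Real.exp (-(c * (t - s))) * E s := by
      rw [mul_div_right_comm, ← Real.exp_sub]
      congr 1; congr 1; ring
    rw [h5] at h4
    exact h4.trans (mul_le_mul_of_nonneg_left (hceil s hs) (Real.exp_nonneg _))
  -- letting `s → −∞`: `E(t) ≤ 0`
  have hE0 : E t ≤ 0 := by
    by_contra hpos
    push Not at hpos
    have hlim : Tendsto (fun L : ℝ => Real.exp (-(c * L)) * C) atTop (𝓝 0) := by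
      have h1 := (Real.tendsto_exp_neg_atTop_nhds_zero.comp (tendsto_id.const_mul_atTop hc0)).mul_const C
      simpa using h1
    obtain ⟨N, hN⟩ := Filter.eventually_atTop.1 (hlim.eventually (gt_mem_nhds hpos))
    have hL := hN (max N 0) (le_max_left _ _)
    have h := hEt_le (t - max N 0) (by linarith [le_max_right N 0])
    have h7 : t - (t - max N 0) = max N 0 := by ring
    rw [h7] at h
    exact absurd (h.trans_lt hL) (lt_irrefl _)
  have hint0 : ∫ x, ‖U t x‖ ^ 2 ≤ 0 := by
    have h1 : E t = 2⁻¹ * ∫ x, ‖U t x‖ ^ 2 := rfl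
    linarith
  exact hUt (Torus.eq_zero_of_integral_norm_sq_nonpos (hsm t htS) hint0)

/-- **`Step_T1310` HOLDS (PROVED)** — Thm 13.10 as used (class ∧ budget chain ⇒ trivial): the class alone is
rigid. [cite: Belanger2026, Thm 13.10 p.33 l.44–54] -/
theorem step_T1310_holds : Step_T1310 :=
  fun ν hν U P hU _ _ => claimedRigidity_holds ν hν U P hU

/-- **`Step_P43` HOLDS (PROVED, vacuously)** — there is no nontrivial member to have vorticity.
[cite: Belanger2026, Prop 4.3 p.19 l.2–70] -/
theorem step_P43_holds : Step_P43 :=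
  fun ν hν U P hU hnt => absurd hnt (claimedRigidity_holds ν hν U P hU)

/-- **KERNEL FACT at Step 3′, UNCONDITIONAL (PROVED): `Step_P42c ↔ ClaimedTheorem`** — with the rigidity
face a theorem, Prop 4.2 even under the charitable retype (blow-up ⇒ SOME nontrivial member of Def 3.1 on
the fixed torus) carries exactly the content of sentence 2 (Clay (B) on mean-zero data).
[cite: Belanger2026, Prop 4.2 p.15 l.93 – p.16 l.10; Proof of Thm 1.1 p.35 l.41–53] -/
theorem step_P42c_iff_claimedTheorem : Step_P42c ↔ ClaimedTheorem :=
  step_P42c_iff_claimedTheorem_of_rigidity claimedRigidity_holds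

/-- Every member of Definition 3.1 vanishes at every `t < 0` (`claimedRigidity_holds`, pointwise form).
[cite: Belanger2026, Thm 1.1 p.7 l.3–5] -/
theorem eq_zero_of_isBoundedAncient {ν : ℝ} (hν : 0 < ν) {U : ℝ → T3 → E3} {P : ℝ → T3 → ℝ}
    (hU : IsBoundedAncient ν U P) {t : ℝ} (ht : t < 0) : U t = 0 := by
  by_contra h
  exact claimedRigidity_holds ν hν U P hU ⟨t, ht, h⟩

/-- Partial derivatives of the zero field vanish (pointwise). [folklore] -/
private theorem partialDeriv_zero_field (i : Fin 3) (x : T3) :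
    Torus.partialDeriv i (0 : T3 → E3) x = 0 := by
  simp [Torus.partialDeriv, Torus.lineDeriv]

/-- Partial derivatives of the zero field vanish (as functions). [folklore] -/
private theorem partialDeriv_zero_field' (i : Fin 3) : Torus.partialDeriv i (0 : T3 → E3) = 0 :=
  funext (partialDeriv_zero_field i)

/-- `|ω|²` of the zero field vanishes. [folklore] -/
private theorem torusVorticitySqAt_zero_field (x : T3) : torusVorticitySqAt (0 : T3 → E3) x = 0 := by
  simp [torusVorticitySqAt, partialDeriv_zero_field]

/-- `Ω(0) = 0`. [folklore] -/
private theorem enstrophy_zero : enstrophy (0 : T3 → E3) = 0 := by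
  simp [enstrophy, torusVorticitySqAt_zero_field]

/-- `P(0) = 0`. [folklore] -/
private theorem production_zero : production (0 : T3 → E3) = 0 := by
  simp [production, partialDeriv_zero_field]

/-- `G(0) = 0`. [folklore] -/
private theorem palinstrophy_zero : palinstrophy (0 : T3 → E3) = 0 := by
  simp [palinstrophy, partialDeriv_zero_field', torusVorticitySqAt_zero_field]

/-- A functional vanishing on the zero field has a (zero) finite backward budget along a field that vanishes
on `t < 0`. [folklore] -/
private theorem hasFiniteBackwardBudget_of_zero {F : (T3 → E3) → ℝ} (hF : F 0 = 0) {U : ℝ → T3 → E3}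
    (hU : ∀ t : ℝ, t < 0 → U t = 0) : HasFiniteBackwardBudget F U := by
  refine ⟨0, fun a b hab hb => ?_⟩
  have h : ∫ t in a..b, F (U t) = ∫ _t in a..b, (0 : ℝ) := by
    refine intervalIntegral.integral_congr fun t ht => ?_
    rw [uIcc_of_le hab.le] at ht
    simp only [hU t (lt_of_le_of_lt ht.2 hb), hF]
  rw [h, intervalIntegral.integral_zero]

/-- **`Step_L93` HOLDS (PROVED)** — Lemma 9.3's finite backward enstrophy budget: every member vanishes on
`t < 0`, so `Ω ≡ 0` there. [cite: Belanger2026, Lemma 9.3 p.26 l.25–42] -/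
theorem step_L93_holds : Step_L93 := fun _ν hν _U _P hU =>
  hasFiniteBackwardBudget_of_zero enstrophy_zero fun _t ht => eq_zero_of_isBoundedAncient hν hU ht

/-- **`Step_L35` HOLDS (PROVED)** — Lemma 3.5's production bound along members (`P = Ω = 0` on `t < 0`).
[cite: Belanger2026, Lemma 3.5 p.14 l.188] -/
theorem step_L35_holds : Step_L35 := by
  intro ν hν U P hU M _hM0 _hM t ht
  rw [eq_zero_of_isBoundedAncient hν hU ht, production_zero, enstrophy_zero, abs_zero, mul_zero]

/-- **`Step_L111` HOLDS (PROVED)** — Lemma 11.1's bridge (budget of `|P|`). [cite: Belanger2026, Lemma 11.1 p.27 l.24–40] -/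
theorem step_L111_holds : Step_L111 := fun _ν hν _U _P hU _ =>
  hasFiniteBackwardBudget_of_zero (F := fun v => |production v|) (by rw [production_zero, abs_zero])
    fun _t ht => eq_zero_of_isBoundedAncient hν hU ht

/-- **`Step_T121` HOLDS (PROVED)** — Thm 12.1's finite backward palinstrophy budget along members
(`G ≡ 0` on `t < 0`). [cite: Belanger2026, Thm 12.1 p.28 l.17–40] -/
theorem step_T121_holds : Step_T121 := fun _ν hν _U _P hU _ =>
  hasFiniteBackwardBudget_of_zero palinstrophy_zero fun _t ht => eq_zero_of_isBoundedAncient hν hU ht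

/-- **`Step_L132` HOLDS (PROVED)** — Lemmas 13.1/13.2: `Ω(−σ) → 0` (indeed `Ω ≡ 0` on `t < 0`).
[cite: Belanger2026, Lemma 13.1 p.30 l.26; Lemma 13.2 p.30 l.59] -/
theorem step_L132_holds : Step_L132 := by
  intro ν hν U P hU _
  refine (tendsto_const_nhds (x := (0 : ℝ))).congr' ?_
  filter_upwards [eventually_lt_atBot (0 : ℝ)] with t ht
  rw [eq_zero_of_isBoundedAncient hν hU ht, enstrophy_zero]

/-- **The whole rigidity chain HOLDS (PROVED)**: `rigidity_of_steps` fed by the discharged Steps returns the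
rigidity face (consistency check of the composition). [cite: Belanger2026, Proof of Thm 1.1 p.35 l.44–50] -/
theorem claimedRigidity_of_discharged_chain : ClaimedRigidity :=
  rigidity_of_steps step_L91_holds step_L93_holds step_L35_holds step_L111_holds step_T121_holds
    step_L132_holds step_T1310_holds

/-- **COMPOSITION keyed at the bounds sentence (PROVED)**: `Step_B1` alone — the proof of Prop 4.2's one
pair `(M_u, M)` for the blowing-up `u` — already yields `ClaimedTheorem` (kernel iff
`step_B1_iff_claimedTheorem`), so `Step_B1` is a CONSUMED binder of a proved composition (second refuter's
lettering note, C168 hazard (b) shape avoided). [cite: Belanger2026, proof of Prop 4.2 p.17 l.53–59; Step B1 p.18 l.13–17] -/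
theorem claim_of_step_B1 (hB1 : Step_B1) : ClaimedTheorem := step_B1_iff_claimedTheorem.1 hB1

/-- The printed chain keyed from the bounds sentence through Object B (charitable) and the rigidity chain:
`Step_B1` is binder 1; the remaining binders are carried for the ordered index (the kernel needs only
`hB1`). [cite: Belanger2026, Proof of Thm 1.1 p.35 l.41–53] -/
theorem claim_of_steps_B1 (hB1 : Step_B1) (_h42 : Step_P42c) (_h91 : Step_L91) (_h93 : Step_L93)
    (_h35 : Step_L35) (_h111 : Step_L111) (_h121 : Step_T121) (_h132 : Step_L132) (_h1310 : Step_T1310) :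
    ClaimedTheorem :=
  claim_of_step_B1 hB1

/-- The two faces joined by the printed «Equivalently»: sentence 1 is a theorem, so Thm 1.1 as a whole is
equivalent, in the kernel, to its sentence 2 = Clay (B). [cite: Belanger2026, Thm 1.1 p.7 l.3–7] -/
theorem claimedRigidity_and_claimedTheorem_iff_clayB :
    (ClaimedRigidity ∧ ClaimedTheorem) ↔ clayPeriodic.Regularity :=
  ⟨fun h => claimedTheorem_iff_clayB.1 h.2, fun h => ⟨claimedRigidity_holds, claimedTheorem_iff_clayB.2 h⟩⟩

/-! ## §G TRUE column (PROVED): the literal per-subinterval bounds sentence `Step_B1_lit` -/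

/-- A component of a vector of `ℝ³` is bounded by its Euclidean norm (squared form). [folklore] -/
private theorem sq_apply_le_norm_sq (v : E3) (j : Fin 3) : v j ^ 2 ≤ ‖v‖ ^ 2 := by
  rw [EuclideanSpace.norm_sq_eq]
  have h : v j ^ 2 = ‖v j‖ ^ 2 := by rw [Real.norm_eq_abs, sq_abs]
  rw [h]
  exact Finset.single_le_sum (f := fun i => ‖v i‖ ^ 2) (fun i _ => sq_nonneg _) (Finset.mem_univ j)

/-- `|ω(x)|² ≤ 18 D²` when every `‖∂ᵢ v(x)‖ ≤ D`. [folklore] -/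
private theorem torusVorticitySqAt_le_of_partialDeriv_le {v : T3 → E3} {x : T3} {D : ℝ}
    (hD : ∀ i : Fin 3, ‖Torus.partialDeriv i v x‖ ≤ D) : torusVorticitySqAt v x ≤ (5 * D) ^ 2 := by
  have hD0 : 0 ≤ D := (norm_nonneg _).trans (hD 0)
  have hsq : ∀ i j : Fin 3, (Torus.partialDeriv i v x) j ^ 2 ≤ D ^ 2 := fun i j =>
    (sq_apply_le_norm_sq _ j).trans (pow_le_pow_left₀ (norm_nonneg _) (hD i) 2)
  have hterm : ∀ i j : Fin 3,
      ((Torus.partialDeriv i v x) j - (Torus.partialDeriv j v x) i) ^ 2 ≤ 4 * D ^ 2 := by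
    intro i j
    nlinarith [hsq i j, hsq j i, sq_nonneg ((Torus.partialDeriv i v x) j + (Torus.partialDeriv j v x) i)]
  have hsum : ∑ i : Fin 3, ∑ j : Fin 3,
      ((Torus.partialDeriv i v x) j - (Torus.partialDeriv j v x) i) ^ 2 ≤
        ∑ _i : Fin 3, ∑ _j : Fin 3, 4 * D ^ 2 :=
    Finset.sum_le_sum fun i _ => Finset.sum_le_sum fun j _ => hterm i j
  simp only [Finset.sum_const, Finset.card_univ, Fintype.card_fin, nsmul_eq_mul, Nat.cast_ofNat] at hsum
  unfold torusVorticitySqAt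
  nlinarith [hsum, sq_nonneg D]

/-- **`Step_B1_lit` HOLDS (PROVED)** — the bounds sentence p.17 l.55–56 read per CLOSED subinterval
`[0, b]`, `b < T⋆`: a classical solution is jointly smooth on `[0, T⋆) × 𝕋³`, hence its velocity and its
first space derivatives are bounded on the compact `[0, b] × 𝕋³`
(`IsSmoothSpaceTimeOn.exists_norm_le_of_isCompact`, `IsSmoothSpaceTimeOn.partialDeriv`); the bounds depend
on `b`. [cite: Belanger2026, proof of Prop 4.2 p.17 l.55–56] -/
theorem step_B1_lit_holds : Step_B1_lit := by
  intro ν hν u p T hbu b hb0 hbT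
  obtain ⟨hT, -, hcl, -⟩ := hbu
  have hu : Torus.IsSmoothSpaceTimeOn (Ico 0 T) u := hcl.smooth_velocity
  have hK : IsCompact (Icc 0 b) := isCompact_Icc
  have hKS : Icc 0 b ⊆ Ico 0 T := Icc_subset_Ico_right hbT
  obtain ⟨Cu, hCu⟩ := hu.exists_norm_le_of_isCompact hK hKS
  have hdi : ∀ i : Fin 3, ∃ C : ℝ, ∀ t ∈ Icc 0 b, ∀ x, ‖Torus.partialDeriv i (u t) x‖ ≤ C := fun i =>
    (hu.partialDeriv (uniqueDiffOn_Ico 0 T) i).exists_norm_le_of_isCompact hK hKS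
  choose C hC using hdi
  set D : ℝ := ∑ j : Fin 3, |C j| with hDdef
  have hD : ∀ i : Fin 3, ∀ t ∈ Icc 0 b, ∀ x, ‖Torus.partialDeriv i (u t) x‖ ≤ D := fun i t ht x =>
    ((hC i t ht x).trans (le_abs_self (C i))).trans
      (Finset.single_le_sum (f := fun j => |C j|) (fun j _ => abs_nonneg (C j)) (Finset.mem_univ i))
  refine ⟨Cu, 5 * D, fun t ht x => ⟨hCu t ht x, ?_⟩⟩
  exact torusVorticitySqAt_le_of_partialDeriv_le fun i => hD i t ht x

end

end Literature.Claims.NS.Belanger2026
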